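import Summits.CriticalPhenomena.PercolationContinuityZ3.Theorems.PercNearOneGluingNoHeavyLowerTailMixMetaA2
import Summits.CriticalPhenomena.PercolationContinuityZ3.Theorems.PercNearOneGluingNoHeavyLowerTailCovTauMetaA2Anti
import Summits.CriticalPhenomena.PercolationContinuityZ3.Theorems.PercNearOneGluingNoHeavyLowerTailCovTauStarBridgeS
import HarnessLib

/-!
# Pinned hierarchy — META-A2 / (Htw) with a GENERAL monotone cluster functional as the first observer (finite-sum core)

Definitions file (`--supports stmt-CriticalPhenomena-4575`), route task `nh-dp-fatminority` (line fat-minority-linear, gen 16); memo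
`run/shared/lean/prim/prim-nh-dp-fatminority/CSH-PSI-MEMO.md` §2 (K8), (K9)_ψ, (Htw)_ψ.  No named facts, no sorries.  Second brick
of the Lean proof of memo THEOREM 1_ψ (`PinCSH.Holds`).

prim-hp-4's `CovTau.metaA2_of_star` / `CovTau.a2H` / `CovTau.p1H_univ` run van den Berg–Häggström–Kahn's two-source induction for the
observer functional `E_A(N) = μ_{G[U]}(o ∈ C_v, v ↮ A ∪ N)` (`CovTau.Eav`, the vertex test `1{o ∈ C_v}` = `CovTau.oInd o v` read on
the open EDGE cluster of `v`).  The pinned hierarchy needs the same with the PINNED test `ψ(C_v) = 1{o ∈ C_v}·1{C_v ∈ 𝓗}`, and the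
only properties of `oInd` the induction uses are: a function of the edge cluster of `v`, monotone, with values in `[0,1]`.  This file
runs it ONCE for an arbitrary such functional `θ`:

* `CovTau.EavG w U A θ v N = E_{G[U]}[θ(C_v); v ↮ A ∪ N]` — the observer functional of `θ` (`Eav = EavG (oInd o v)`, `Eav_eq_EavG`);
  nonnegative, `≤ M_A`, antitone in `N`, vanishing for `v ∈ A ∪ N`, star decomposition `EavG_step` (BHK's identity (6)), and the CORE
  INEQUALITY `EavG(N)·M_A(N') ≤ EavG(∅)·M_A(N ∪ N')` (`EavG_mul_Mav_le`: BHK Theorem 1.1/1.3 for `C_v` given `v ↮ A`, `BHK2006.core` with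
  `F = θ`, `G = 1`);
* `CovTau.metaA2G_of_star` — META-A2 (memo (K8)) with `θ`: `EavG(N)·Y_F(N') ≤ M_A(N ∪ N')·Y_{q^θ F}(N ∩ N')`, `q^θ(U') = EavG_{U'}(∅)/M_{U'}(∅)`,
  for a pure world functional `F ≥ 0` obeying the one-source bound (★^F) and (anti) — `CovTau.metaA2_abstract` (prim-ineq-gen-7) with
  `(f₁,f₂,f₃,f₄) = (EavG, Y_F, M_A, Y_{q^θ F})`;
* `CovTau.a2G`, `CovTau.p1G_univ` — (K9)_ψ "A2^H" and its diagonal (Htw)_ψ for the covariance functional `H_{G[U']}(v) = Cov(g(C_x), 1{v ↔ S})`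
  (`CovTau.BfS`), from prim-ineq-prove-1's one-source bounds `CovTauStarN.yS_mul_mS_le` / `yS_le_bS` — verbatim `CovTau.a2H` / `p1H_univ`
  with `θ` for `oInd`.
[cite: VandenbergHaggstromKahn2005, Thm. 1.1 (pp. 3–5), Thm. 1.3 (p. 6), §1 identity (6) (p. 4)] [cite: Gladkov2024, Thm. 3.2 (p. 4)]
[cite: KozmaNitzan2024, Conj. 4 (p. 32), Question 7 (p. 36)]
-/

noncomputable section

namespace Summit.CriticalPhenomena.PercolationContinuityZ3.Theorems.CovTau

open Literature.Probability.Percolation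
open Literature.Probability.Percolation.BHK2006
open Literature.Probability.Percolation.DecisionTree (ind ind_of_mem ind_of_not_mem ind_nonneg)
open scoped Classical

variable {V : Type*} [Fintype V]

/-! ### The observer functional of a general cluster functional -/

/-- `E^θ_A(N) = E_{G[U]}[θ(C_v) ; v ↮ A ∪ N]` — the observer functional of an arbitrary functional `θ` of the open EDGE cluster of `v`
in the world `G[U]` (memo (K9)_ψ: `⟨e⟩_N` with `θ = ψ`; `θ = 1{o ∈ ·}` is `CovTau.Eav`).
(transcription of the memo prim-nh-dp-fatminority CSH-PSI-MEMO.md §2 (K9)_ψ) [cite: VandenbergHaggstromKahn2005, §1 p. 3] -/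
def EavG (w : Sym2 V → ℝ) (U : Finset V) (A : Set V) (θ : Set (Sym2 V) → ℝ) (v : V) (N : Set V) : ℝ :=
  ∑ ω, weight w ω * (θ (rC U v ω) * ind (rD U v (A ∪ N)) ω)

/-- `CovTau.Eav` is `EavG` of the vertex test `oInd o v`. [folklore] -/
theorem Eav_eq_EavG (w : Sym2 V → ℝ) (U : Finset V) (A : Set V) (o v : V) (N : Set V) :
    Eav w U A o v N = EavG w U A (oInd o v) v N := rfl

/-- `E^θ_A(N) = 0` when `v ∈ A ∪ N`. [folklore] -/
theorem EavG_eq_zero_of_mem (w : Sym2 V → ℝ) (U : Finset V) (A : Set V) (θ : Set (Sym2 V) → ℝ) (v : V) {N : Set V}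
    (hv : v ∈ A ∪ N) : EavG w U A θ v N = 0 :=
  Finset.sum_eq_zero fun ω _ => by
    rw [rD_eq_empty hv, ind_of_not_mem (Set.notMem_empty ω)]; ring

/-- `E^θ_A` only sees `(A ∪ N) ∩ U` (for `v ∈ U`). [folklore] -/
theorem EavG_eq_inter (w : Sym2 V → ℝ) (U : Finset V) (A : Set V) (θ : Set (Sym2 V) → ℝ) {v : V} (hv : v ∈ U)
    (N : Set V) : EavG w U A θ v N = ∑ ω, weight w ω * (θ (rC U v ω) * ind (rD U v ((A ∪ N) ∩ ↑U)) ω) := by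
  unfold EavG; rw [rD_inter_coe U hv]

/-- Star decomposition of `E^θ_A`: `E^θ_U(N) = Σ_ω weight(ω) · E^θ_{U∖Z}((N ∖ Z) ∪ S(ω))` for `Z ⊆ N`, `v ∈ U ∖ Z` (`BHK2006.step_sum`).
[cite: VandenbergHaggstromKahn2005, §1 p. 4, identity (6)] -/
theorem EavG_step {U Z : Finset V} (hZU : Z ⊆ U) {v : V} (hvU : v ∈ U) (hv : v ∉ Z) {A N : Set V}
    (hZN : (↑Z : Set V) ⊆ N) (w : Sym2 V → ℝ) (hm : ∑ ω, weight w ω = 1) (θ : Set (Sym2 V) → ℝ) :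
    EavG w U A θ v N = ∑ ω, weight w ω * EavG w (U \ Z) A θ v ((N \ ↑Z) ∪ rS U Z ω) := by
  have hZW : (↑Z : Set V) ⊆ A ∪ N := hZN.trans Set.subset_union_right
  have hvUZ : v ∈ U \ Z := Finset.mem_sdiff.2 ⟨hvU, hv⟩
  unfold EavG
  rw [step_sum hZU hv hZW w hm θ]
  refine Finset.sum_congr rfl fun ω _ => ?_
  simp only [blockE, rD_eq_of_agree (U \ Z) hvUZ (union_diff_agree U Z A N (rS U Z ω))]

section Props

variable {w : Sym2 V → ℝ} (hw0 : ∀ e, 0 ≤ w e) (hw1 : ∀ e, w e ≤ 1) {θ : Set (Sym2 V) → ℝ}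
  (hθ0 : ∀ C, 0 ≤ θ C) (hθ1 : ∀ C, θ C ≤ 1)
include hw0 hw1 hθ0

/-- `E^θ_A(N) ≥ 0`. [folklore] -/
theorem EavG_nonneg (U : Finset V) (A : Set V) (v : V) (N : Set V) : 0 ≤ EavG w U A θ v N :=
  sum_ind_nonneg hw0 hw1 (fun _ => hθ0 _) _

/-- `E^θ_A` is antitone in the source set. [cite: VandenbergHaggstromKahn2005, §1 p. 3] -/
theorem EavG_antitone (U : Finset V) (A : Set V) (v : V) {N N' : Set V} (h : N ⊆ N') :
    EavG w U A θ v N' ≤ EavG w U A θ v N :=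
  sum_ind_mono hw0 hw1 (fun _ => hθ0 _) (rD_antitone (Set.union_subset_union_right A h))

include hθ1 in
omit hθ0 in
/-- `E^θ_A(N) ≤ M_A(N)`. [folklore] -/
theorem EavG_le_Mav (U : Finset V) (A : Set V) (v : V) (N : Set V) : EavG w U A θ v N ≤ Mav w U A v N :=
  Finset.sum_le_sum fun ω _ => mul_le_mul_of_nonneg_left
    (by simpa only [one_mul] using
      mul_le_mul_of_nonneg_right (hθ1 (rC U v ω)) (ind_nonneg (rD U v (A ∪ N)) ω))
    (weight_nonneg hw0 hw1 ω)

/-- **Core inequality for the observer functional of a monotone `θ`**: `E^θ_A(N)·M_A(N') ≤ E^θ_A(∅)·M_A(N ∪ N')` for `v ∈ U`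
(BHK Theorem 1.1 for `C_v` in `G[U]` with `F = θ`, `G = 1`, then antitonicity).
[cite: VandenbergHaggstromKahn2005, Thm. 1.1 (pp. 3–5), Thm. 1.3 (p. 6)] -/
theorem EavG_mul_Mav_le (hm : ∑ ω, weight w ω = 1) (hθ : Monotone θ) (A : Set V) {v : V} {U : Finset V} (hvU : v ∈ U)
    (N N' : Set V) : EavG w U A θ v N * Mav w U A v N' ≤ EavG w U A θ v ∅ * Mav w U A v (N ∪ N') := by
  have hcore := core w hw0 hw1 hm U v hvU ((A ∪ N) ∩ ↑U) ((A ∪ N') ∩ ↑U)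
    Set.inter_subset_right Set.inter_subset_right θ (fun _ => (1 : ℝ))
    hθ monotone_const hθ0 (fun _ => zero_le_one)
  have hi : ∀ a ∈ U, a ∈ (A ∪ N) ∩ ↑U ∩ ((A ∪ N') ∩ ↑U) ↔ a ∈ A ∪ (N ∩ N') := fun a haU => by
    simp only [Set.mem_inter_iff, Set.mem_union, Finset.mem_coe]
    tauto
  have hu : ∀ a ∈ U, a ∈ (A ∪ N) ∩ ↑U ∪ (A ∪ N') ∩ ↑U ↔ a ∈ A ∪ (N ∪ N') := fun a haU => by
    simp only [Set.mem_inter_iff, Set.mem_union, Finset.mem_coe]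
    tauto
  simp only [one_mul, mul_one] at hcore
  rw [rD_eq_of_agree U hvU hi, rD_eq_of_agree U hvU hu, ← EavG_eq_inter w U A θ hvU N, ← Mav_eq_inter w U A hvU N'] at hcore
  change EavG w U A θ v N * Mav w U A v N' ≤ EavG w U A θ v (N ∩ N') * Mav w U A v (N ∪ N') at hcore
  exact hcore.trans (mul_le_mul_of_nonneg_right (EavG_antitone hw0 hw1 hθ0 U A v (Set.empty_subset _))
    (Mav_nonneg hw0 hw1 U A v _))

end Props

/-! ### META-A2 with a general cluster functional -/

/-- **META-A2 with the observer functional of a monotone `[0,1]`-valued cluster functional `θ`, modulo the one-source bounds for `F`**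
(memo (K8) with (K9)_ψ's first functional): for every `N, N' ⊆ U`,
`E^θ_A(N) · Y_F(N') ≤ M_A(N ∪ N') · Y_{q^θ·F}(N ∩ N')`, `q^θ(U') = E^θ_A(∅)/M_A(∅)` in `G[U']`, for a pure world functional `F ≥ 0`
vanishing on worlds without `v` and obeying (★^F) and (anti).  Proof: `CovTau.metaA2_abstract` with `(EavG, Y_F, M_A, Y_{q^θ F})`, the star
decompositions, and the disjoint-sources bound from (★^F) and `EavG_mul_Mav_le`.
[cite: VandenbergHaggstromKahn2005, Thm. 1.1 (pp. 3–5), Thm. 1.3 (p. 6), §1 identity (6) (p. 4)] -/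
theorem metaA2G_of_star (w : Sym2 V → ℝ) (hw0 : ∀ e, 0 ≤ w e) (hw1 : ∀ e, w e ≤ 1)
    (hm : ∑ ω, weight w ω = 1) (x v : V) (A : Set V) {θ : Set (Sym2 V) → ℝ} (hθ : Monotone θ)
    (hθ0 : ∀ C, 0 ≤ θ C) (hθ1 : ∀ C, θ C ≤ 1) {F : Finset V → ℝ}
    (hF0 : ∀ U' : Finset V, 0 ≤ F U') (hFv : ∀ U' : Finset V, v ∉ U' → F U' = 0) (U : Finset V)
    (hstar : ∀ U' ⊆ U, ∀ N : Set V, N ⊆ ↑U' →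
      Yw w U' x F N * Mav w U' A v ∅ ≤ Mav w U' A v N * F U')
    (hanti : ∀ U' ⊆ U, ∀ N N' : Set V, N ⊆ N' → N' ⊆ ↑U' → Yw w U' x F N' ≤ Yw w U' x F N) :
    ∀ N N' : Set V, N ⊆ ↑U → N' ⊆ ↑U →
      EavG w U A θ v N * Yw w U x F N' ≤
        Mav w U A v (N ∪ N') * Yw w U x (fun U' => EavG w U' A θ v ∅ / Mav w U' A v ∅ * F U') (N ∩ N') := by
  -- the fourth functional is nonnegative
  have hq0 : ∀ U' : Finset V, 0 ≤ EavG w U' A θ v ∅ / Mav w U' A v ∅ * F U' := fun U' =>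
    mul_nonneg (div_nonneg (EavG_nonneg hw0 hw1 hθ0 U' A v ∅) (Mav_nonneg hw0 hw1 U' A v ∅)) (hF0 U')
  refine metaA2_abstract w hw0 hw1 hm (fun U' Z => v ∈ U' ∧ v ∉ Z ∧ x ∉ Z)
    (fun U' N => EavG w U' A θ v N) (fun U' N => Yw w U' x F N) (fun U' N => Mav w U' A v N)
    (fun U' N => Yw w U' x (fun U'' => EavG w U'' A θ v ∅ / Mav w U'' A v ∅ * F U'') N)
    (fun U' N => EavG_nonneg hw0 hw1 hθ0 U' A v N) (fun U' N => Yw_nonneg hw0 hw1 U' x hF0 N)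
    (fun U' N => Mav_nonneg hw0 hw1 U' A v N) (fun U' N => Yw_nonneg hw0 hw1 U' x hq0 N) U
    ?_ ?_ ?_ ?_ ?_ ?_ ?_ ?_
  · -- admissibility from non-vanishing
    intro U' _ N N' _ _ hne Z _ hZ
    have h1 : EavG w U' A θ v N ≠ 0 := fun h => hne (by rw [h, zero_mul])
    have h2 : Yw w U' x F N' ≠ 0 := fun h => hne (by rw [h, mul_zero])
    have hvU' : v ∈ U' := by
      by_contra hv; exact h2 (Yw_eq_zero_of_not_mem w x hFv hv N')
    have hvN : v ∉ A ∪ N := fun hv => h1 (EavG_eq_zero_of_mem w U' A θ v hv)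
    have hxN' : x ∉ N' := fun hx => h2 (Yw_eq_zero_of_mem w U' x F hx)
    exact ⟨hvU', fun hvZ => hvN (Or.inr (hZ (Finset.mem_coe.2 hvZ)).1),
      fun hxZ => hxN' (hZ (Finset.mem_coe.2 hxZ)).2⟩
  · intro U' _ Z hZU' hAdm _ N hZN _
    exact EavG_step hZU' hAdm.1 hAdm.2.1 hZN w hm θ
  · intro U' _ Z hZU' hAdm _ N hZN _
    exact Yw_step hZU' hAdm.2.2 hZN w hm F
  · intro U' _ Z hZU' hAdm _ N hZN _
    exact Mav_step hZU' hAdm.1 hAdm.2.1 hZN w hm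
  · intro U' _ Z hZU' hAdm _ N hZN _
    exact Yw_step hZU' hAdm.2.2 hZN w hm _
  · intro U' _ N N' hNN' _
    exact EavG_antitone hw0 hw1 hθ0 U' A v hNN'
  · exact hanti
  · -- disjoint sources: `(★^F)`, the core inequality, division by `M(∅)`
    intro U' hU' N N' hNU' hN'U' hNN'
    rw [Yw_empty w hm]
    have hRHS : 0 ≤ Mav w U' A v (N ∪ N') * (EavG w U' A θ v ∅ / Mav w U' A v ∅ * F U') :=
      mul_nonneg (Mav_nonneg hw0 hw1 U' A v _) (hq0 U')
    by_cases hvU' : v ∈ U'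
    swap
    · rw [Yw_eq_zero_of_not_mem w x hFv hvU' N', mul_zero]; exact hRHS
    have hM0 := Mav_nonneg hw0 hw1 U' A v (∅ : Set V) (w := w)
    have hEN := EavG_nonneg hw0 hw1 hθ0 U' A v N (w := w)
    have hE0 := EavG_nonneg hw0 hw1 hθ0 U' A v (∅ : Set V) (w := w)
    have hst := hstar U' hU' N' hN'U'
    have hcore := EavG_mul_Mav_le hw0 hw1 hθ0 hm hθ A hvU' N N'
    have key : EavG w U' A θ v N * Yw w U' x F N' * Mav w U' A v ∅ ≤
        Mav w U' A v (N ∪ N') * (EavG w U' A θ v ∅ * F U') :=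
      calc EavG w U' A θ v N * Yw w U' x F N' * Mav w U' A v ∅
          = EavG w U' A θ v N * (Yw w U' x F N' * Mav w U' A v ∅) := by ring
        _ ≤ EavG w U' A θ v N * (Mav w U' A v N' * F U') := mul_le_mul_of_nonneg_left hst hEN
        _ = (EavG w U' A θ v N * Mav w U' A v N') * F U' := by ring
        _ ≤ (EavG w U' A θ v ∅ * Mav w U' A v (N ∪ N')) * F U' := mul_le_mul_of_nonneg_right hcore (hF0 U')
        _ = _ := by ring
    rcases hM0.eq_or_lt with hM0e | hM0p
    · have hEN0 : EavG w U' A θ v N = 0 := le_antisymm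
        ((EavG_le_Mav hw0 hw1 hθ1 U' A v N).trans
          ((Mav_antitone hw0 hw1 U' A v (Set.empty_subset N)).trans hM0e.symm.le)) hEN
      rw [hEN0, zero_mul]; exact hRHS
    · calc EavG w U' A θ v N * Yw w U' x F N'
          = EavG w U' A θ v N * Yw w U' x F N' * Mav w U' A v ∅ / Mav w U' A v ∅ := by
            field_simp
        _ ≤ Mav w U' A v (N ∪ N') * (EavG w U' A θ v ∅ * F U') / Mav w U' A v ∅ :=
            div_le_div_of_nonneg_right key hM0p.le
        _ = Mav w U' A v (N ∪ N') * (EavG w U' A θ v ∅ / Mav w U' A v ∅ * F U') := by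
            field_simp

/-! ### (K9)_ψ and (Htw)_ψ for the covariance functional `H_{G[U']}(v) = Cov(g(C_x), 1{v ↔ S})` -/

/-- **(K9)_ψ A2^H with a general monotone `[0,1]`-valued observer functional `θ`**: for a marker set `S ∋ x` with `v ∉ S`, a monotone
edge-cluster functional `g ≥ 0` and `H_{G[U']}(v) = Cov_{G[U']}(g(C_x), 1{v ↔ S})` (`CovTau.BfS`), for all `N, N' ⊆ U`:
`E^θ_S(N)·Y^H(N') ≤ M_S(N ∪ N')·Y_{q^θ H}(N ∩ N')` (= `CovTau.a2H` at `θ = oInd o v`).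
[cite: VandenbergHaggstromKahn2005, Thm. 1.1 (pp. 3–5), Thm. 1.4 (p. 7)] [cite: Gladkov2024, Thm. 3.2 (p. 4)] -/
theorem a2G (w : Sym2 V → ℝ) (hw0 : ∀ e, 0 ≤ w e) (hw1 : ∀ e, w e ≤ 1) (hm : ∑ ω, weight w ω = 1)
    {x v : V} {S : Set V} (hxS : x ∈ S) (hvS : v ∉ S) {θ : Set (Sym2 V) → ℝ} (hθ : Monotone θ)
    (hθ0 : ∀ C, 0 ≤ θ C) (hθ1 : ∀ C, θ C ≤ 1) {g : Set (Sym2 V) → ℝ} (hg : Monotone g)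
    (hg0 : ∀ C, 0 ≤ g C) (U : Finset V) {N N' : Set V} (hNU : N ⊆ ↑U) (hN'U : N' ⊆ ↑U) :
    EavG w U S θ v N * Yw w U x (fun U' => BfS w U' x S v g) N' ≤
      Mav w U S v (N ∪ N') *
        Yw w U x (fun U' => EavG w U' S θ v ∅ / Mav w U' S v ∅ * BfS w U' x S v g) (N ∩ N') :=
  metaA2G_of_star w hw0 hw1 hm x v S hθ hθ0 hθ1 (F := fun U' => BfS w U' x S v g)
    (fun U' => BfS_nonneg hw0 hw1 hm U' x S v hg hg0) (fun _ hv => BfS_eq_zero_of_not_mem w x hv hvS g) U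
    (fun U' _ N _ => CovTauStarN.yS_mul_mS_le w hw0 hw1 hxS hvS hg hg0 U' N)
    (fun U' _ _ _ hNN' hN'U' => Yw_antitone_of_le w hw0 hw1 hm x (fun U'' => BfS w U'' x S v g) U'
      (fun U'' _ u => CovTauStarN.yS_le_bS w hw0 hw1 x hvS hg hg0 U'' {u}) hNN' hN'U') N N' hNU hN'U

/-- **(Htw)_ψ on the whole graph** — the diagonal of `a2G` at `U = univ`: for every marker set `S ∋ x` with `v ∉ S`, every source set
`Y`, every monotone edge-cluster functional `g ≥ 0` and every monotone `[0,1]`-valued observer functional `θ`,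
`E^θ_S(Y)·Y^H(Y) ≤ M_S(Y)·Y_{q^θ H}(Y)` in `G = G[univ]`, i.e. `E_π[(q^θ_S(G ∖ C_Y) − p^θ)·H_{G∖C_Y}(v); x ∉ C_Y] ≥ 0`
(memo (Htw)_ψ). [cite: VandenbergHaggstromKahn2005, Thm. 1.1 (pp. 3–5)] [cite: Gladkov2024, Thm. 3.2 (p. 4)] -/
theorem p1G_univ (w : Sym2 V → ℝ) (hw0 : ∀ e, 0 ≤ w e) (hw1 : ∀ e, w e ≤ 1) (hm : ∑ ω, weight w ω = 1)
    {x v : V} {S : Set V} (hxS : x ∈ S) (hvS : v ∉ S) {θ : Set (Sym2 V) → ℝ} (hθ : Monotone θ)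
    (hθ0 : ∀ C, 0 ≤ θ C) (hθ1 : ∀ C, θ C ≤ 1) {g : Set (Sym2 V) → ℝ} (hg : Monotone g)
    (hg0 : ∀ C, 0 ≤ g C) (Y : Set V) :
    EavG w Finset.univ S θ v Y * Yw w Finset.univ x (fun U' => BfS w U' x S v g) Y ≤
      Mav w Finset.univ S v Y *
        Yw w Finset.univ x (fun U' => EavG w U' S θ v ∅ / Mav w U' S v ∅ * BfS w U' x S v g) Y := by
  have h := a2G w hw0 hw1 hm hxS hvS hθ hθ0 hθ1 hg hg0 Finset.univ (N := Y) (N' := Y) (by simp) (by simp)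
  simpa only [Set.union_self, Set.inter_self] using h

end Summit.CriticalPhenomena.PercolationContinuityZ3.Theorems.CovTau

end
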